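import Summits.Ventures.PercRepro.ProfileTwoCosimple

/-!
# PercRepro — THE ROW `q = 3` OF (Π): RANK-3 SETS, RANK-2 SETS AND LEVELS IN THE TWO MINORS AT A POINT
(p10, gen 6; `proofs/P10-Q3-NOSPLIT.md`; the step itself is in `ProfileThreeNoSplit`)

The bookkeeping of the single-point deletion step at a non-loop `z`: the rank-3 sets of `M ∖ z` are the rank-3
sets of `M` avoiding `z` (`Rq_delete_eq_filter`); the rank-2 sets of `M ／ z` are the rank-3 sets `B' ∋ z` of
`M` minus `z` (`sum_Rq_contract_two`, as a reindexing of sums); the rank-`u` sets of `M` split into those of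
`M ∖ z` and those of `M ／ z` at level `u − 1` (`card_levelSet_split`, from p10 g0's `card_shadowLevel_split`);
and the demands in the minors are read off ranks in `M` (`demand_delete_eq_ite'`, `demand_delete_le`,
`demand_contract_erase`).

* `rk_mono_sub` — ranks are monotone; `Rq_delete_eq_filter`; `demand_delete_eq_ite'`, `demand_delete_le`;
* `demand_contract_erase` — the `(2, u−1)`-demand of `B' ∖ z` in `M ／ z` is `[u−1 ≤ p''] · C(p'', u−3)` with
  `p'' + 1 = ρ(E ∖ (B' ∖ z))`;
* `shadowLevel_singleton_empty`, `card_levelSet_split`, `sum_Rq_contract_two`.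
-/

open scoped Matroid

namespace PercRepro.Cogirth

open Finset ThmH Skew Shadow Profile

variable {α : Type} [DecidableEq α] {M : Matroid α} [M.Finite]

/-! ### Ranks and demands in the minors -/

omit [DecidableEq α] in
/-- Ranks are monotone. -/
theorem rk_mono_sub {X Y : Finset α} (h : X ⊆ Y) : rk M X ≤ rk M Y := by
  have hXY : (X : Set α) ⊆ (Y : Set α) := by exact_mod_cast h
  have := M.eRk_mono hXY
  rw [← coe_rk, ← coe_rk] at this
  exact_mod_cast this

/-- The rank-3 sets of `M ∖ z` are the rank-3 sets of `M` avoiding `z`. -/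
theorem Rq_delete_eq_filter (z : α) (q : ℕ) :
    Rq (M ＼ ({z} : Set α)) q = (Rq M q).filter (fun B => z ∉ B) := by
  ext B
  rw [mem_filter, mem_Rq, mem_Rq, gr_delete']
  constructor
  · rintro ⟨hB, hr⟩
    have hzB : z ∉ B := fun h => (mem_erase.1 (hB h)).1 rfl
    refine ⟨⟨(subset_erase.1 hB).1, ?_⟩, hzB⟩
    rw [delete_singleton_eRk_eq (by rw [← coe_gr, ← Finset.coe_erase]; exact_mod_cast hB)] at hr
    exact hr
  · rintro ⟨⟨hB, hr⟩, hzB⟩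
    have hB' : B ⊆ (gr M).erase z := subset_erase.2 ⟨hB, hzB⟩
    refine ⟨hB', ?_⟩
    rw [delete_singleton_eRk_eq (by rw [← coe_gr, ← Finset.coe_erase]; exact_mod_cast hB')]
    exact hr

/-- The demand of a rank-3 set `B ∌ z` in `M ∖ z`, read in `M`. -/
theorem demand_delete_eq_ite' (q u : ℕ) (B : Finset α) (z : α) :
    demand (M ＼ ({z} : Set α)) q u B =
      if u ≤ rk M ((gr M \ B).erase z) then (rk M ((gr M \ B).erase z)).choose (u - q) else 0 := by
  unfold demand
  have hsub : (gr M \ B).erase z ⊆ (gr M).erase z := erase_subset_erase z sdiff_subset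
  rw [gr_delete', erase_sdiff, rk_delete hsub]

/-- Deleting `z` does not raise the demand of a set `B ∌ z`. -/
theorem demand_delete_le (q u : ℕ) (B : Finset α) (z : α) :
    demand (M ＼ ({z} : Set α)) q u B ≤ demand M q u B := by
  rw [demand_delete_eq_ite']
  unfold demand
  have hle : rk M ((gr M \ B).erase z) ≤ rk M (gr M \ B) := rk_mono_sub (erase_subset z _)
  split_ifs with h1 h2
  · exact Nat.choose_le_choose _ hle
  · omega
  · exact Nat.zero_le _
  · exact le_refl _

/-- The `(2, u−1)`-demand of `C = B' ∖ z` in `M ／ z`, for a rank-3 set `B' ∋ z` of `M`, read in `M`: with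
`p'' + 1 = ρ(E ∖ (B' ∖ z))`, it is `[u − 1 ≤ p''] · C(p'', u − 3)`. -/
theorem demand_contract_erase {z : α} (hz : M.Indep {z}) (u : ℕ) {B' : Finset α} (hzB' : z ∈ B') :
    demand (M ／ ({z} : Set α)) 2 (u - 1) (B'.erase z) =
      if u - 1 ≤ rk M (gr M \ B'.erase z) - 1 then (rk M (gr M \ B'.erase z) - 1).choose (u - 3) else 0 := by
  have hzE : z ∈ gr M := mem_gr_of_indep hz
  have hzC : z ∉ gr M \ B' := fun h => (mem_sdiff.1 h).2 hzB'
  have hC' : gr M \ B' ⊆ (gr M).erase z := subset_erase.2 ⟨sdiff_subset, hzC⟩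
  have hins : insert z (gr M \ B') = gr M \ B'.erase z := by
    ext x
    simp only [mem_insert, mem_sdiff, mem_erase, not_and]
    constructor
    · rintro (rfl | ⟨hx1, hx2⟩)
      · exact ⟨hzE, fun h => absurd rfl h⟩
      · exact ⟨hx1, fun _ => hx2⟩
    · rintro ⟨hx1, hx2⟩
      by_cases hxz : x = z
      · exact Or.inl hxz
      · exact Or.inr ⟨hx1, hx2 hxz⟩
  have hr : rk (M ／ ({z} : Set α)) (gr M \ B') + 1 = rk M (gr M \ B'.erase z) := by
    rw [rk_contract_add_one hz hC', hins]
  unfold demand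
  rw [gr_contract', Shadow.erase_sdiff_erase, Finset.erase_eq_of_notMem hzC]
  have hr' : rk (M ／ ({z} : Set α)) (gr M \ B') = rk M (gr M \ B'.erase z) - 1 := by omega
  rw [hr']
  have : u - 1 - 2 = u - 3 := by omega
  rw [this]


/-- `(E ∖ (B' ∖ z)) ∖ z = E ∖ B'` for `z ∈ B'`. -/
theorem sdiff_erase_erase_eq {B' : Finset α} {z : α} (hzB' : z ∈ B') :
    (gr M \ B'.erase z).erase z = gr M \ B' := by
  ext x
  simp only [mem_erase, mem_sdiff, not_and]
  constructor
  · rintro ⟨hxz, hx1, hx2⟩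
    exact ⟨hx1, fun h => hx2 hxz h⟩
  · rintro ⟨hx1, hx2⟩
    have hxz : x ≠ z := fun h => hx2 (h ▸ hzB')
    exact ⟨hxz, hx1, fun _ => hx2⟩

/-- `shadowLevel M u {∅} = levelSet M u`. -/
theorem shadowLevel_singleton_empty (u : ℕ) : shadowLevel M u ({∅} : Finset (Finset α)) = levelSet M u := by
  ext S
  rw [mem_shadowLevel, mem_levelSet]
  constructor
  · rintro ⟨h, _⟩; exact h
  · intro h; exact ⟨h, ∅, mem_singleton_self _, empty_subset _⟩

/-- **The level split**: `#{ρ(S) = u} = #{ρ_{M∖z}(S) = u} + #{ρ_{M／z}(S) = u − 1}` for a non-loop `z`, `u ≥ 1`. -/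
theorem card_levelSet_split {z : α} (hz : M.Indep {z}) {u : ℕ} (hu : 1 ≤ u) :
    (levelSet M u).card =
      (levelSet (M ＼ ({z} : Set α)) u).card + (levelSet (M ／ ({z} : Set α)) (u - 1)).card := by
  have h := card_shadowLevel_split hz hu ({∅} : Finset (Finset α))
    (fun B hB => by rw [mem_singleton.1 hB]; exact notMem_empty z)
  rwa [shadowLevel_singleton_empty, shadowLevel_singleton_empty, shadowLevel_singleton_empty] at h

/-- **The rank-2 sets of `M ／ z` are the rank-3 sets of `M` through `z`, minus `z`**: summing a function over
them is summing its composite with `B' ↦ B' ∖ z` over the rank-3 sets `B' ∋ z`. -/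
theorem sum_Rq_contract_two {z : α} (hz : M.Indep {z}) (f : Finset α → ℕ) :
    ∑ C ∈ Rq (M ／ ({z} : Set α)) 2, f C = ∑ B' ∈ (Rq M 3).filter (fun B => z ∈ B), f (B'.erase z) := by
  have hzE : z ∈ gr M := mem_gr_of_indep hz
  refine sum_nbij' (fun C => insert z C) (fun B' => B'.erase z) ?_ ?_ ?_ ?_ ?_
  · intro C hC
    rw [mem_Rq, gr_contract'] at hC
    obtain ⟨hCg, hCr⟩ := hC
    rw [mem_filter, mem_Rq]
    refine ⟨⟨insert_subset hzE (subset_erase.1 hCg).1, ?_⟩, mem_insert_self _ _⟩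
    have h1 := rk_contract_add_one hz hCg
    have h2 : rk (M ／ ({z} : Set α)) C = 2 := by unfold rk; rw [hCr, ENat.toNat_coe]
    rw [← coe_rk, ← h1, h2]
  · intro B' hB'
    rw [mem_filter, mem_Rq] at hB'
    obtain ⟨⟨hBg, hBr⟩, hzB⟩ := hB'
    rw [mem_Rq, gr_contract']
    have hC' : B'.erase z ⊆ (gr M).erase z := erase_subset_erase z hBg
    refine ⟨hC', ?_⟩
    have h1 := rk_contract_add_one hz hC'
    rw [insert_erase hzB] at h1
    have h2 : rk M B' = 3 := by unfold rk; rw [hBr, ENat.toNat_coe]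
    rw [← coe_rk]
    have : rk (M ／ ({z} : Set α)) (B'.erase z) = 2 := by omega
    rw [this]
  · intro C hC
    rw [mem_Rq, gr_contract'] at hC
    have hzC : z ∉ C := fun h => (mem_erase.1 (hC.1 h)).1 rfl
    exact erase_insert hzC
  · intro B' hB'
    rw [mem_filter] at hB'
    exact insert_erase hB'.2
  · intro C hC
    rw [mem_Rq, gr_contract'] at hC
    have hzC : z ∉ C := fun h => (mem_erase.1 (hC.1 h)).1 rfl
    rw [erase_insert hzC]

end PercRepro.Cogirth
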